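import Mathlib
import Literature.Combinatorics.Additive.LinearVosper
import Literature.Combinatorics.Additive.LinearVosperValuation
import Literature.RingTheory.Valuation.RationalPlace
import HarnessLib

/-!
# Bachoc–Serra–Zémor, Theorem 34: Lemmas 4 and 5 and the assembly

Topic `Literature/Combinatorics/Additive`. Discharge of the named fact
`Literature.Combinatorics.Additive.LinearVosperAlgClosed` (`LinearVosper.lean`): C. Bachoc,
O. Serra, G. Zémor, *An analogue of Vosper's theorem for extension fields*, Math. Proc. Cambridge
Philos. Soc. 163 (2017) = arXiv:1501.00602 [BachocSerraZemor2017], **Theorem 34** (§7, p. 16):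
over an algebraically closed `F`, finite-dimensional `S, T ⊆ L` with `dim S, dim T ≥ 2` and
`dim(ST) = dim S + dim T - 1` have bases in geometric progression with a common ratio.

We follow the printed proof.
* §7, proof of Thm 34 (valuation step, file `LinearVosperValuation.lean` +
  `Literature.RingTheory.Valuation.RationalPlace`): an `F`-rational place of `L` exists because
  `F` is algebraically closed; removing top graded pieces of `T` reduces to a `2`-dimensional
  `A = ⟨a₁, a₂⟩ ⊆ T` with `dim(SA) ≤ dim S + 1`, i.e. `dim(S + aS) ≤ dim S + 1` for `a = a₂/a₁ ∉ F`.
* §2, Lemma 4 (`exists_forall_mul_pow_mem`): then `S = ⟨g, ga, …, ga^{s-1}⟩`, by induction on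
  `s = dim S` through `S' = S ∩ aS`.
* §2, Lemma 5 (`exists_forall_mul_pow_mem_of_span_pow`): if `S = ⟨1, a, …, a^{s-1}⟩` and
  `dim(ST) ≤ s + dim T - 1` then `T = ⟨g', g'a, …⟩`, by induction on `s` through
  `S' = ⟨a, …, a^{s-1}⟩`, the base case `s = 2` being Lemma 4 for `T`.

Deviations from the printed text (simplifications available here because `F` is algebraically
closed, so that `a ∉ F` is transcendental): (i) the hypotheses of Lemmas 4 and 5 are carried as
inequalities `dim(AS) ≤ dim S + 1`, `dim(ST) ≤ dim S + dim T - 1`, which makes the appeals to the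
linear Cauchy–Davenport inequality (loc. cit. Thm 2) in the printed proofs unnecessary; (ii) the
steps "`aS = S` (resp. `W = aW`) is impossible" are `exists_algebraMap_eq_of_map_mulLeft_le`:
multiplication by `a` would have an eigenvector in the finite-dimensional space (`F` algebraically
closed), forcing `a ∈ F`; (iii) "`{g, ga, …}` is a basis" is obtained from the membership of
these vectors in `S` by counting dimensions (`span_eq_of_forall_mul_pow_mem`, powers of a
transcendental element are linearly independent).
-/

namespace Literature.Combinatorics.Additive

namespace BachocSerraZemor

open Module Polynomial

variable {F L : Type*} [Field F] [Field L] [Algebra F L]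

/-! ### Multiplication by a fixed element, eigenvalues, transcendence -/

/-- `aM`, the image of a subspace `M` under multiplication by `a`, is the product `⟨a⟩ M` of
subspaces. [folklore] -/
theorem map_mulLeft_eq_span_singleton_mul (c : L) (M : Submodule F L) :
    M.map (LinearMap.mulLeft F c) = (F ∙ c) * M := by
  ext x
  simp [Submodule.mem_map, Submodule.mem_span_singleton_mul]

/-- `(cM) T = c (M T)`. [folklore] -/
theorem map_mulLeft_mul (c : L) (M T : Submodule F L) :
    M.map (LinearMap.mulLeft F c) * T = (M * T).map (LinearMap.mulLeft F c) := by
  rw [map_mulLeft_eq_span_singleton_mul, map_mulLeft_eq_span_singleton_mul, mul_assoc]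

/-- Multiplication by `c ≠ 0` preserves dimensions of subspaces. [folklore] -/
theorem finrank_map_mulLeft {c : L} (hc : c ≠ 0) (M : Submodule F L) :
    finrank F ↥(M.map (LinearMap.mulLeft F c)) = finrank F M :=
  (Submodule.equivMapOfInjective _ (fun _ _ hxy => mul_right_injective₀ hc hxy) M).finrank_eq.symm

/-- **`aW ⊆ W` forces `a ∈ F`** for a non-zero finite-dimensional subspace `W` over an
algebraically closed `F`: multiplication by `a` restricts to an endomorphism of `W`, which has an
eigenvector `w ≠ 0`, `a w = c w`, so `a = c`. (Replaces the degree arguments "`deg_F(a) < dim L`"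
of the printed proofs of Lemmas 4 and 5.) [folklore] -/
theorem exists_algebraMap_eq_of_map_mulLeft_le [IsAlgClosed F] (W : Submodule F L)
    [FiniteDimensional F W] (hW : W ≠ ⊥) {a : L}
    (haW : W.map (LinearMap.mulLeft F a) ≤ W) : ∃ c : F, algebraMap F L c = a := by
  haveI : Nontrivial W := Submodule.nontrivial_iff_ne_bot.mpr hW
  have hmem : ∀ w ∈ W, LinearMap.mulLeft F a w ∈ W := fun w hw =>
    haW (Submodule.mem_map_of_mem hw)
  let f : W →ₗ[F] W := (LinearMap.mulLeft F a).restrict hmem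
  obtain ⟨c, hc⟩ := Module.End.exists_eigenvalue f
  obtain ⟨w, hw⟩ := hc.exists_hasEigenvector
  refine ⟨c, ?_⟩
  have h1 : a * (w : L) = c • (w : L) := by
    have := congrArg Subtype.val hw.apply_eq_smul
    simpa [f] using this
  have hw0 : (w : L) ≠ 0 := fun h => hw.2 (Subtype.ext h)
  rw [Algebra.smul_def] at h1
  exact (mul_right_cancel₀ hw0 h1).symm

/-- Over an algebraically closed `F`, an element of `L ∖ F` is transcendental. [folklore] -/
theorem transcendental_of_forall_ne [IsAlgClosed F] {a : L} (ha : ∀ c : F, algebraMap F L c ≠ a) :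
    Transcendental F a := fun halg => by
  obtain ⟨c, hc⟩ :=
    Literature.RingTheory.Valuation.exists_algebraMap_eq_of_isIntegral halg.isIntegral
  exact ha c hc

/-- The vectors `g aⁱ (i < n)` are linearly independent when `a` is transcendental and `g ≠ 0`
(cf. Mathlib's `linearIndependent_pow`). [folklore] -/
theorem linearIndependent_mul_pow {a g : L} (ha : Transcendental F a) (hg : g ≠ 0) (n : ℕ) :
    LinearIndependent F fun i : Fin n => g * a ^ (i : ℕ) := by
  refine Fintype.linearIndependent_iff.2 fun c hc i => ?_
  have h1 : ∑ j, c j • (g * a ^ (j : ℕ)) = g * aeval a (∑ j : Fin n, monomial (j : ℕ) (c j)) := by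
    rw [map_sum, Finset.mul_sum]
    refine Finset.sum_congr rfl fun j _ => ?_
    rw [aeval_monomial, Algebra.smul_def]
    ring
  rw [h1, mul_eq_zero] at hc
  have h3 : (∑ j : Fin n, monomial (j : ℕ) (c j) : F[X]) = 0 :=
    transcendental_iff_injective.mp ha (by rw [hc.resolve_left hg, map_zero])
  have h4 := congrArg (lcoeff F (i : ℕ)) h3
  rw [map_zero] at h4
  simp_rw [map_sum, lcoeff_apply, coeff_monomial, Fin.val_eq_val, Finset.sum_ite_eq'] at h4
  rwa [if_pos (Finset.mem_univ _)] at h4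

/-- **From membership to a basis**: if `g ≠ 0`, `a` is transcendental and the `dim S` vectors
`g aⁱ (i < dim S)` lie in `S`, they span `S`. [folklore] -/
theorem span_eq_of_forall_mul_pow_mem {a g : L} (ha : Transcendental F a) (hg : g ≠ 0)
    (S : Submodule F L) [FiniteDimensional F S] {n : ℕ} (hn : finrank F S = n)
    (hmem : ∀ i : ℕ, i < n → g * a ^ i ∈ S) :
    Submodule.span F (Set.range fun i : Fin n => g * a ^ (i : ℕ)) = S := by
  apply Submodule.eq_of_le_of_finrank_eq
  · rw [Submodule.span_le]
    rintro _ ⟨i, rfl⟩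
    exact hmem i i.2
  · rw [finrank_span_eq_card (linearIndependent_mul_pow ha hg n), Fintype.card_fin, hn]

/-- Linear Cauchy–Davenport for a `2`-dimensional factor over an algebraically closed `F`:
`dim(S + aS) ≥ dim S + 1` when `S ≠ 0` and `a ∉ F` (otherwise `aS ⊆ S`). [folklore] -/
theorem finrank_add_one_le_finrank_sup [IsAlgClosed F] (S : Submodule F L)
    [FiniteDimensional F S] (hS : S ≠ ⊥) {a : L} (ha : ∀ c : F, algebraMap F L c ≠ a) :
    finrank F S + 1 ≤ finrank F ↥(S ⊔ S.map (LinearMap.mulLeft F a)) := by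
  by_contra hlt
  have heq : S = S ⊔ S.map (LinearMap.mulLeft F a) :=
    Submodule.eq_of_le_of_finrank_le le_sup_left (by omega)
  have hle : S.map (LinearMap.mulLeft F a) ≤ S :=
    calc S.map (LinearMap.mulLeft F a) ≤ S ⊔ S.map (LinearMap.mulLeft F a) := le_sup_right
      _ = S := heq.symm
  obtain ⟨c, hc⟩ := exists_algebraMap_eq_of_map_mulLeft_le S hS hle
  exact ha c hc

/-! ### Lemma 4 -/

/-- **Bachoc–Serra–Zémor, Lemma 4** (over an algebraically closed `F`, with the hypothesis as an
inequality): if `a ∉ F`, `dim S = n + 1` and `dim(S + aS) ≤ n + 2`, then for some `g ≠ 0` all of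
`g, ga, …, gaⁿ` lie in `S` (hence form a basis of `S`, `span_eq_of_forall_mul_pow_mem`).
Induction on `n` through `S' = S ∩ aS`, which has dimension `n` (it is `≠ S` since `aS = S` would
put `a` in `F`) and satisfies `S' + aS' ⊆ aS`; if `g', g'a, …` lie in `S'` then `g' = ga` with
`g ∈ S`. [cite: BachocSerraZemor2017, Lemma 4 (§2, p. 5)] -/
theorem exists_forall_mul_pow_mem [IsAlgClosed F] {a : L} (ha : ∀ c : F, algebraMap F L c ≠ a)
    (n : ℕ) : ∀ (S : Submodule F L), FiniteDimensional F S → finrank F S = n + 1 →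
      finrank F ↥(S ⊔ S.map (LinearMap.mulLeft F a)) ≤ n + 2 →
        ∃ g : L, g ≠ 0 ∧ ∀ i : ℕ, i ≤ n → g * a ^ i ∈ S := by
  have ha0 : a ≠ 0 := fun h => ha 0 (by rw [map_zero, h])
  induction n with
  | zero =>
    intro S _ hS _
    have hSne : S ≠ ⊥ := by
      rw [Ne, ← Submodule.finrank_eq_zero, hS]
      omega
    obtain ⟨g, hgS, hg⟩ := Submodule.exists_mem_ne_zero_of_ne_bot hSne
    refine ⟨g, hg, fun i hi => ?_⟩
    rw [Nat.le_zero.mp hi, pow_zero, mul_one]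
    exact hgS
  | succ n ih =>
    intro S _ hS hsup
    have hSne : S ≠ ⊥ := by
      rw [Ne, ← Submodule.finrank_eq_zero, hS]
      omega
    set aS := S.map (LinearMap.mulLeft F a) with haS_def
    have haS : finrank F aS = n + 2 := by rw [haS_def, finrank_map_mulLeft ha0, hS]
    have hdim := Submodule.finrank_sup_add_finrank_inf_eq S aS
    rw [hS, haS] at hdim
    set S' := S ⊓ aS with hS'_def
    haveI : FiniteDimensional F S' := Submodule.finiteDimensional_of_le inf_le_left
    have hS'ne : S' ≠ S := by
      intro h
      have hle : S ≤ aS := by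
        rw [← h]
        exact inf_le_right
      have heq : S = aS := Submodule.eq_of_le_of_finrank_eq hle (by rw [hS, haS])
      obtain ⟨c, hc⟩ := exists_algebraMap_eq_of_map_mulLeft_le S hSne (a := a) heq.symm.le
      exact ha c hc
    have hS'lt : S' < S := lt_of_le_of_ne inf_le_left hS'ne
    have h1 := Submodule.finrank_lt_finrank_of_lt hS'lt
    rw [hS] at h1
    have hS' : finrank F S' = n + 1 := by omega
    have hsup' : finrank F ↥(S' ⊔ S'.map (LinearMap.mulLeft F a)) ≤ n + 2 := by
      calc finrank F ↥(S' ⊔ S'.map (LinearMap.mulLeft F a)) ≤ finrank F aS :=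
            Submodule.finrank_mono (sup_le inf_le_right (Submodule.map_mono inf_le_left))
        _ = n + 2 := haS
    obtain ⟨g', hg', hmem⟩ := ih S' inferInstance hS' hsup'
    have hg'S' : g' ∈ S' := by simpa using hmem 0 (Nat.zero_le n)
    obtain ⟨g, hgS, hgg'⟩ := Submodule.mem_map.mp (inf_le_right (a := S) (b := aS) hg'S')
    rw [LinearMap.mulLeft_apply] at hgg'
    refine ⟨g, ?_, fun i hi => ?_⟩
    · rintro rfl
      rw [mul_zero] at hgg'
      exact hg' hgg'.symm
    · rcases i with _ | j
      · simpa using hgS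
      · have hj : j ≤ n := by omega
        have h2 : g * a ^ (j + 1) = g' * a ^ j := by
          rw [← hgg']
          ring
        rw [h2]
        exact inf_le_left (a := S) (b := aS) (hmem j hj)

/-! ### Lemma 5 -/

/-- The spaces `⟨1, a, …, aᵏ⟩` increase with `k`. [folklore] -/
theorem span_pow_mono (a : L) (k : ℕ) :
    Submodule.span F (Set.range fun i : Fin k => a ^ (i : ℕ)) ≤
      Submodule.span F (Set.range fun i : Fin (k + 1) => a ^ (i : ℕ)) :=
  Submodule.span_mono (Set.range_subset_iff.2 fun i => ⟨Fin.castSucc i, by simp⟩)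

/-- `1 ∈ ⟨1, a, …, aᵏ⟩`. [folklore] -/
theorem one_mem_span_pow (a : L) (k : ℕ) :
    (1 : L) ∈ Submodule.span F (Set.range fun i : Fin (k + 1) => a ^ (i : ℕ)) :=
  Submodule.subset_span ⟨0, by simp⟩

/-- `⟨1, a, …, aᵏ⟩ = ⟨1⟩ + a⟨1, a, …, aᵏ⁻¹⟩`. [folklore] -/
theorem span_pow_succ (a : L) (k : ℕ) :
    Submodule.span F (Set.range fun i : Fin (k + 1) => a ^ (i : ℕ)) =
      (F ∙ (1 : L)) ⊔ (Submodule.span F (Set.range fun i : Fin k => a ^ (i : ℕ))).map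
        (LinearMap.mulLeft F a) := by
  rw [Submodule.map_span, ← Submodule.span_union, Set.singleton_union]
  congr 1
  ext x
  simp only [Set.mem_range, Set.mem_insert_iff, Set.mem_image, exists_exists_eq_and,
    LinearMap.mulLeft_apply]
  constructor
  · rintro ⟨i, rfl⟩
    refine Fin.cases (Or.inl (by simp)) (fun j => Or.inr ⟨j, ?_⟩) i
    simp [pow_succ']
  · rintro (rfl | ⟨j, rfl⟩)
    · exact ⟨0, by simp⟩
    · exact ⟨j.succ, by simp [pow_succ']⟩

/-- `⟨1, a, …, aᵏ⟩ T = T + a (⟨1, …, aᵏ⁻¹⟩ T)` ("`ST = T + S'T`" in the printed proof of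
Lemma 5). [folklore] -/
theorem span_pow_succ_mul (a : L) (k : ℕ) (T : Submodule F L) :
    Submodule.span F (Set.range fun i : Fin (k + 1) => a ^ (i : ℕ)) * T =
      T ⊔ (Submodule.span F (Set.range fun i : Fin k => a ^ (i : ℕ)) * T).map
        (LinearMap.mulLeft F a) := by
  rw [span_pow_succ, Submodule.sup_mul, ← Submodule.one_eq_span, one_mul, map_mulLeft_mul]

/-- **Bachoc–Serra–Zémor, Lemma 5** (over an algebraically closed `F`, with the hypothesis as an
inequality): let `a ∉ F`, `Sₘ = ⟨1, a, …, a^{m+1}⟩` (dimension `m + 2`) and `T ≠ 0`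
finite-dimensional with `dim(Sₘ T) ≤ (m + 2) + dim T - 1`. Then for some `g' ≠ 0` all of
`g', g'a, …, g'a^{dim T - 1}` lie in `T`. Induction on `m`: for `m = 0`, `S₀T = T + aT` and this
is Lemma 4 for `T`; for the step, `Sₘ₊₁ T = T + aW` with `W = Sₘ T ⊇ T`, and
`dim T + dim(aW) - dim(T ∩ aW) = dim(Sₘ₊₁T)`: either `T ∩ aW ≠ T`, and then
`dim W = dim(aW) ≤ (m + 2) + dim T - 1` so the induction hypothesis applies, or `T ⊆ aW`, and then
`W ⊆ Sₘ₊₁T = aW` have equal dimensions, so `W = aW`, impossible as `a ∉ F`.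
[cite: BachocSerraZemor2017, Lemma 5 (§2, p. 5)] -/
theorem exists_forall_mul_pow_mem_of_span_pow [IsAlgClosed F] {a : L}
    (ha : ∀ c : F, algebraMap F L c ≠ a) (m : ℕ) :
    ∀ (T : Submodule F L), FiniteDimensional F T → T ≠ ⊥ →
      finrank F ↥(Submodule.span F (Set.range fun i : Fin (m + 2) => a ^ (i : ℕ)) * T) ≤
          m + 2 + finrank F T - 1 →
        ∃ g' : L, g' ≠ 0 ∧ ∀ j : ℕ, j < finrank F T → g' * a ^ j ∈ T := by
  have ha0 : a ≠ 0 := fun h => ha 0 (by rw [map_zero, h])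
  induction m with
  | zero =>
    intro T _ hT h
    have hP : Submodule.span F (Set.range fun i : Fin 2 => a ^ (i : ℕ)) * T =
        T ⊔ T.map (LinearMap.mulLeft F a) := by
      rw [span_pow_succ_mul, span_pow_succ_mul]
      simp
    rw [hP] at h
    obtain ⟨n, hn⟩ : ∃ n, finrank F T = n + 1 :=
      ⟨finrank F T - 1, by
        have : finrank F T ≠ 0 := by rwa [Ne, Submodule.finrank_eq_zero]
        omega⟩
    rw [hn] at h
    obtain ⟨g, hg, hmem⟩ := exists_forall_mul_pow_mem ha n T inferInstance hn (by omega)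
    exact ⟨g, hg, fun j hj => hmem j (by omega)⟩
  | succ m ih =>
    intro T _ hT h
    set W := Submodule.span F (Set.range fun i : Fin (m + 2) => a ^ (i : ℕ)) * T with hW_def
    have hPT : Submodule.span F (Set.range fun i : Fin (m + 1 + 2) => a ^ (i : ℕ)) * T =
        T ⊔ W.map (LinearMap.mulLeft F a) := span_pow_succ_mul a (m + 2) T
    haveI : FiniteDimensional F W := Module.Finite.iff_fg.mpr
      ((Submodule.fg_span (Set.finite_range _)).mul (Module.Finite.iff_fg.mp ‹_›))
    have hTW : T ≤ W := fun t ht => by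
      simpa using Submodule.mul_mem_mul (one_mem_span_pow (F := F) a (m + 1)) ht
    have hWne : W ≠ ⊥ := fun h0 => hT (eq_bot_iff.mpr (h0 ▸ hTW))
    set aW := W.map (LinearMap.mulLeft F a) with haW_def
    have haW : finrank F aW = finrank F W := finrank_map_mulLeft ha0 W
    have hdim := Submodule.finrank_sup_add_finrank_inf_eq T aW
    rw [← hPT] at hdim
    by_cases hcase : T ⊓ aW = T
    · exfalso
      have hTaW : T ≤ aW := inf_eq_left.mp hcase
      have hPT' :
          Submodule.span F (Set.range fun i : Fin (m + 1 + 2) => a ^ (i : ℕ)) * T = aW := by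
        rw [hPT]
        exact sup_eq_right.mpr hTaW
      have hWle : W ≤ aW := by
        rw [← hPT', hW_def]
        exact mul_le_mul_left (span_pow_mono a (m + 2)) T
      have hWeq : W = aW := Submodule.eq_of_le_of_finrank_eq hWle haW.symm
      obtain ⟨c, hc⟩ := exists_algebraMap_eq_of_map_mulLeft_le W hWne (a := a) hWeq.symm.le
      exact ha c hc
    · have hlt : T ⊓ aW < T := lt_of_le_of_ne inf_le_left hcase
      have h1 := Submodule.finrank_lt_finrank_of_lt hlt
      have hW : finrank F W ≤ m + 2 + finrank F T - 1 := by omega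
      exact ih T inferInstance hT hW

end BachocSerraZemor

/-! ### Theorem 34 -/

open Module BachocSerraZemor in
/-- **Bachoc–Serra–Zémor, Theorem 34** — discharge of the named fact `LinearVosperAlgClosed`:
over an algebraically closed `F`, if `S, T ⊆ L` are finite-dimensional with `dim S, dim T ≥ 2`
and `dim(ST) = dim S + dim T - 1`, then `S = ⟨g, ga, …, ga^{dim S - 1}⟩` and
`T = ⟨g', g'a, …, g'a^{dim T - 1}⟩` for some `g, g', a ∈ L`. Proof as printed: an `F`-rational
place of `L` (`Literature.RingTheory.Valuation.exists_valuationSubring_forall_sub_algebraMap_lt`)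
reduces, by removing top graded pieces of `T` (`exists_le_finrank_eq_two`), to a
`2`-dimensional `A ∋ a₁, a₂` inside `T` with `dim(SA) ≤ dim S + 1`; with `a = a₂ / a₁ ∉ F`,
Lemma 4 gives `S = g⟨1, a, …, a^{s-1}⟩` and Lemma 5 (applied to `⟨1, …, a^{s-1}⟩` and `T`, whose
product has the dimension of `ST`) gives `T`. (The hypothesis `L ≠ F` of the fact is not needed:
it follows from `dim S ≥ 2`.) [cite: BachocSerraZemor2017, Thm 34 (§7, p. 16)] -/
theorem LinearVosperAlgClosed_holds : LinearVosperAlgClosed := by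
  intro F L _ _ _ _ _hL S T hSfd hTfd hS2 hT2 hST
  haveI := hSfd
  haveI := hTfd
  -- the place ("we may choose a place with values in ... `F` because `F` is algebraically closed")
  obtain ⟨O, hF, hres⟩ :=
    Literature.RingTheory.Valuation.exists_valuationSubring_forall_sub_algebraMap_lt (F := F) (L := L)
  have hSne : S ≠ ⊥ := by
    rw [Ne, ← Submodule.finrank_eq_zero]
    omega
  have hTne : T ≠ ⊥ := by
    rw [Ne, ← Submodule.finrank_eq_zero]
    omega
  -- reduction to a `2`-dimensional `A ≤ T` with `dim(SA) ≤ dim S + 1`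
  obtain ⟨A, hAT, hA2, hSA⟩ := exists_le_finrank_eq_two O hF hres S hSne (finrank F T - 2) T hTfd
    (by omega) (by omega)
  haveI : FiniteDimensional F A := Submodule.finiteDimensional_of_le hAT
  -- `A ⊇ ⟨a₁, a₂⟩` with `a₁ ≠ 0`, `a₂ ∉ F a₁`
  have hAne : A ≠ ⊥ := by
    rw [Ne, ← Submodule.finrank_eq_zero, hA2]
    omega
  obtain ⟨a₁, ha₁A, ha₁⟩ := Submodule.exists_mem_ne_zero_of_ne_bot hAne
  have hlt : (F ∙ a₁) < A := by
    refine lt_of_le_of_ne ((Submodule.span_singleton_le_iff_mem a₁ A).mpr ha₁A) fun h => ?_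
    have h1 := finrank_span_singleton (K := F) ha₁
    rw [h, hA2] at h1
    omega
  obtain ⟨a₂, ha₂A, ha₂⟩ := SetLike.exists_of_lt hlt
  -- the common ratio `a = a₂ / a₁ ∉ F`
  set a : L := a₂ / a₁ with ha_def
  have ha₁a : a₁ * a = a₂ := by
    rw [ha_def, mul_div_cancel₀ a₂ ha₁]
  have ha : ∀ c : F, algebraMap F L c ≠ a := by
    intro c hc
    apply ha₂
    rw [Submodule.mem_span_singleton]
    refine ⟨c, ?_⟩
    rw [Algebra.smul_def, hc, ← ha₁a, mul_comm]
  have hatr : Transcendental F a := transcendental_of_forall_ne ha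
  -- `dim(S + aS) ≤ dim S + 1` since `a₁ (S + aS) = S a₁ + S a₂ = S⟨a₁, a₂⟩ ⊆ SA`
  have hspan : (F ∙ a₁) ⊔ (F ∙ a₂) ≤ A :=
    sup_le ((Submodule.span_singleton_le_iff_mem a₁ A).mpr ha₁A)
      ((Submodule.span_singleton_le_iff_mem a₂ A).mpr ha₂A)
  have hkey : (S ⊔ S.map (LinearMap.mulLeft F a)).map (LinearMap.mulLeft F a₁) =
      S * ((F ∙ a₁) ⊔ (F ∙ a₂)) := by
    rw [Submodule.map_sup, ← Submodule.map_comp, ← LinearMap.mulLeft_mul, ha₁a, Submodule.mul_sup,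
      Submodule.mul_comm S (F ∙ a₁), Submodule.mul_comm S (F ∙ a₂),
      ← map_mulLeft_eq_span_singleton_mul, ← map_mulLeft_eq_span_singleton_mul]
  haveI : FiniteDimensional F ↥(S * A) := Module.Finite.iff_fg.mpr
    ((Module.Finite.iff_fg.mp hSfd).mul (Module.Finite.iff_fg.mp inferInstance))
  have hfin : finrank F ↥(S ⊔ S.map (LinearMap.mulLeft F a)) ≤ finrank F S + 1 :=
    calc finrank F ↥(S ⊔ S.map (LinearMap.mulLeft F a))
          = finrank F ↥((S ⊔ S.map (LinearMap.mulLeft F a)).map (LinearMap.mulLeft F a₁)) :=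
            (finrank_map_mulLeft ha₁ _).symm
      _ = finrank F ↥(S * ((F ∙ a₁) ⊔ (F ∙ a₂))) := by rw [hkey]
      _ ≤ finrank F ↥(S * A) := Submodule.finrank_mono (mul_le_mul_right hspan S)
      _ ≤ finrank F S + 1 := hSA
  -- Lemma 4: `S = ⟨g, ga, …, ga^{s-1}⟩`
  obtain ⟨g, hg, hgmem⟩ := exists_forall_mul_pow_mem ha (finrank F S - 1) S hSfd (by omega)
    (by omega)
  have hSspan : Submodule.span F (Set.range fun i : Fin (finrank F S) => g * a ^ (i : ℕ)) = S :=
    span_eq_of_forall_mul_pow_mem hatr hg S rfl fun i hi => hgmem i (by omega)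
  -- `S = g ⟨1, a, …, a^{s-1}⟩`, so `dim(⟨1, …, a^{s-1}⟩ T) = dim(ST)`
  have hSmap : S = (Submodule.span F (Set.range fun i : Fin (finrank F S) => a ^ (i : ℕ))).map
      (LinearMap.mulLeft F g) := by
    rw [Submodule.map_span, ← Set.range_comp]
    exact hSspan.symm
  have hST' : finrank F ↥(Submodule.span F (Set.range fun i : Fin (finrank F S) => a ^ (i : ℕ)) * T)
      = finrank F S + finrank F T - 1 := by
    rw [← hST, ← finrank_map_mulLeft hg (_ * T), ← map_mulLeft_mul, ← hSmap]
  -- Lemma 5: `T = ⟨g', g'a, …⟩`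
  have h2 : finrank F S - 2 + 2 = finrank F S := by omega
  obtain ⟨g', hg', hg'mem⟩ := exists_forall_mul_pow_mem_of_span_pow ha (finrank F S - 2) T hTfd
    hTne (by rw [h2, hST'])
  have hTspan : Submodule.span F (Set.range fun i : Fin (finrank F T) => g' * a ^ (i : ℕ)) = T :=
    span_eq_of_forall_mul_pow_mem hatr hg' T rfl hg'mem
  exact ⟨g, g', a, hSspan, hTspan⟩

end Literature.Combinatorics.Additive
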